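import Literature.Topology.FourManifolds.KhComplexTransportProofs
import Literature.Topology.FourManifolds.KhComplexQDegreeProofs
import HarnessLib

/-!
# Homotopy equivalences of Khovanov complexes written on all enhanced states at once

Sibling file of `KhComplex.lean`, a brick of the invariance programme for
`Literature.Topology.FourManifolds.GaussDiagram.nonempty_iso_khovanovHomology_of_equiv`
(Khovanov (2000), Thm. 1). The complexes of `KhComplex` are families of free modules
`degStates i → R` (resp. `bidegStates i j → ℤ`) with the incidence matrices between consecutive
degrees as differentials. The chain maps and homotopies of the Reidemeister moves (Khovanov
(2000), §5; Bar-Natan (2002), §4) are most easily written on the space of *all* functions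
`EnhancedState → R` ("total" cochains), the degrees taking care of themselves; this file provides
the passage from such total data to isomorphisms of the concrete homology groups:

* `extZero`, `resFun` — extension by zero from, and restriction to, a subtype of the basis;
* `totalD` — the total differential `w ↦ (s' ↦ ∑ₛ ⟨d s, s'⟩ w s)`, whose restrictions are the
  differentials `khovanovD i i'` and `khovanovDQ i i' j` (`resFun_totalD_extZero`,
  `resFun_totalD_extZero_bideg`);
* `HtpyData G K` — total linear maps `F : C(G) → C(K)`, `B : C(K) → C(G)`, `H : C(K) → C(K)` with
  `d F = F d`, `d B = B d`, `B F = 1`, `F B - 1 = d H + H d` (a strong deformation retraction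
  of `C(K)` onto `C(G)`, as produced by Gaussian elimination; Bar-Natan (2002), §4, Khovanov
  (2000), §5);
* `HtpyData.nonempty_iso_frobeniusHomology` — **if `F`, `B` preserve the homological degree and
  `H` lowers it by one, such data induce `frobeniusHomology G ≅ frobeniusHomology K` in every
  degree**, and `HtpyData.nonempty_iso_khovanovHomology` — **the bigraded integral version**
  (`F`, `B` of bidegree `(0, 0)`, `H` of bidegree `(-1, 0)`): `Kh^{i,j}(G) ≅ Kh^{i,j}(K)`. Both
  are `subquotientEquiv` (`KhComplexTransportProofs`: homotopy equivalences act on the concrete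
  homology `ker d ⧸ (im d ⊓ ker d)`, no `d² = 0` needed) applied to the restrictions.

Everything is proved; no named fact is introduced.

## References

* M. Khovanov, *A categorification of the Jones polynomial*, Duke Math. J. 101 (2000) 359–426,
  §5 (quasi-isomorphisms for the Reidemeister moves). [cite: Khovanov2000, §5]
* D. Bar-Natan, *On Khovanov's categorification of the Jones polynomial*, Algebr. Geom. Topol. 2
  (2002) 337–370, §4 (invariance proofs: explicit chain maps and homotopies). [cite: BarNatan2002, §4]
* C. A. Weibel, *An introduction to homological algebra* (1994), §1.4 (chain homotopy
  equivalences induce isomorphisms on homology). [folklore]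
-/

open Function Finset

noncomputable section

namespace Literature.Topology.FourManifolds

namespace GaussDiagram

/-! ## Extension by zero and restriction -/

section ExtRes

variable (R : Type) [CommRing R] {α : Type*} (p : α → Prop)

/-- **Restriction** of a function on `α` to the subtype `{a // p a}`. [folklore] -/
def resFun : (α → R) →ₗ[R] ({a // p a} → R) where
  toFun w a := w a.1
  map_add' _ _ := rfl
  map_smul' _ _ := rfl

/-- Restriction, pointwise. [folklore] -/
@[simp]
theorem resFun_apply (w : α → R) (b : {a // p a}) : resFun R p w b = w b.1 := rfl

variable [DecidablePred p]

/-- **Extension by zero** of a function on the subtype `{a // p a}` to all of `α`. [folklore] -/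
def extZero : ({a // p a} → R) →ₗ[R] (α → R) where
  toFun v a := if h : p a then v ⟨a, h⟩ else 0
  map_add' v w := by
    funext a
    by_cases h : p a <;> simp [h]
  map_smul' c v := by
    funext a
    by_cases h : p a <;> simp [h]

variable {R p}

/-- Extension by zero, on the subtype. [folklore] -/
@[simp]
theorem extZero_apply_of {a : α} (h : p a) (v : {a // p a} → R) : extZero R p v a = v ⟨a, h⟩ :=
  dif_pos h

/-- Extension by zero, off the subtype. [folklore] -/
@[simp]
theorem extZero_apply_of_not {a : α} (h : ¬ p a) (v : {a // p a} → R) : extZero R p v a = 0 :=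
  dif_neg h

/-- Extension by zero at a point of the subtype. [folklore] -/
@[simp]
theorem extZero_apply_val (v : {a // p a} → R) (b : {a // p a}) : extZero R p v b.1 = v b := by
  rw [extZero_apply_of b.2]

/-- Restricting an extension by zero gives the function back. [folklore] -/
@[simp]
theorem resFun_extZero (v : {a // p a} → R) : resFun R p (extZero R p v) = v := by
  funext b; simp

/-- Extending the restriction of a function supported on the subtype gives it back. [folklore] -/
theorem extZero_resFun {w : α → R} (hw : ∀ a, ¬ p a → w a = 0) :
    extZero R p (resFun R p w) = w := by
  funext a
  by_cases h : p a
  · rw [extZero_apply_of h]; rfl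
  · rw [extZero_apply_of_not h, hw a h]

/-- A sum against an extension by zero is a sum over the subtype. [folklore] -/
theorem sum_mul_extZero [Fintype α] (Φ : α → R) (v : {a // p a} → R) :
    ∑ a, Φ a * extZero R p v a = ∑ b : {a // p a}, Φ b.1 * v b := by
  classical
  calc ∑ a, Φ a * extZero R p v a
      = ∑ a ∈ Finset.univ.filter p, Φ a * extZero R p v a := by
        rw [← Finset.sum_filter_add_sum_filter_not Finset.univ p, add_eq_left]
        exact Finset.sum_eq_zero fun a ha ↦ by
          rw [Finset.mem_filter] at ha
          rw [extZero_apply_of_not ha.2, mul_zero]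
    _ = ∑ b : {a // p a}, Φ b.1 * extZero R p v b.1 :=
        Finset.sum_subtype _ (by simp) (fun a ↦ Φ a * extZero R p v a)
    _ = ∑ b : {a // p a}, Φ b.1 * v b := by simp

end ExtRes

/-! ## The total differential -/

section Total

variable (G : GaussDiagram) (R : Type) [CommRing R]

/-- **The total differential** of the Khovanov complex of `G` over `A = R[X]/(X² - hX - t)`: on
functions on *all* enhanced states, `w ↦ (s' ↦ ∑ₛ ⟨d s, s'⟩ · w s)`. Its restriction between two
homological degrees is `khovanovD` (`resFun_totalD_extZero`). Khovanov (2000), §4.2; Viro (2004),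
§5.2. [cite: Khovanov2000, §4.2] -/
def totalD (h t : R) : (G.EnhancedState → R) →ₗ[R] (G.EnhancedState → R) where
  toFun w s' := ∑ s, G.incidence R h t s s' * w s
  map_add' v w := by
    funext s'
    simp only [Pi.add_apply, mul_add, Finset.sum_add_distrib]
  map_smul' c v := by
    funext s'
    simp only [Pi.smul_apply, smul_eq_mul, RingHom.id_apply, Finset.mul_sum]
    exact Finset.sum_congr rfl fun s _ ↦ by ring

/-- The total differential, pointwise. [folklore] -/
@[simp]
theorem totalD_apply (h t : R) (w : G.EnhancedState → R) (s' : G.EnhancedState) :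
    G.totalD R h t w s' = ∑ s, G.incidence R h t s s' * w s := rfl

variable {G R}

/-- **Support in a homological degree.** [folklore] -/
def SuppDeg (i : ℤ) (w : G.EnhancedState → R) : Prop := ∀ s, homDegree s ≠ i → w s = 0

/-- **Support in a bidegree.** [folklore] -/
def SuppBideg (i j : ℤ) (w : G.EnhancedState → R) : Prop :=
  ∀ s, ¬ (homDegree s = i ∧ qDegree s = j) → w s = 0

/-- An extension by zero from degree `i` is supported in degree `i`. [folklore] -/
theorem suppDeg_extZero (i : ℤ) (v : G.degStates i → R) :
    SuppDeg i (extZero R (fun s : G.EnhancedState ↦ homDegree s = i) v) := fun _ hs ↦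
  extZero_apply_of_not (p := fun s : G.EnhancedState ↦ homDegree s = i) hs v

/-- An extension by zero from bidegree `(i, j)` is supported in bidegree `(i, j)`. [folklore] -/
theorem suppBideg_extZero (i j : ℤ) (v : G.bidegStates i j → R) :
    SuppBideg i j (extZero R (fun s : G.EnhancedState ↦ homDegree s = i ∧ qDegree s = j) v) :=
  fun _ hs ↦ extZero_apply_of_not (p := fun s : G.EnhancedState ↦ homDegree s = i ∧ qDegree s = j) hs v

/-- The total differential raises the homological degree by one. [folklore] -/
theorem suppDeg_totalD (h t : R) {i : ℤ} {w : G.EnhancedState → R} (hw : SuppDeg i w) :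
    SuppDeg (i + 1) (G.totalD R h t w) := by
  intro s' hs'
  rw [totalD_apply]
  refine Finset.sum_eq_zero fun s _ ↦ ?_
  by_cases h0 : G.incidence R h t s s' = 0
  · rw [h0, zero_mul]
  · rw [hw s (fun hs ↦ hs' (by rw [homDegree_eq_of_incidence_ne_zero h0, hs])), mul_zero]

/-- The integral total differential at `h = t = 0` has bidegree `(1, 0)`
(`qDegree_eq_of_incidence_ne_zero_holds`). [folklore] -/
theorem suppBideg_totalD {i j : ℤ} {w : G.EnhancedState → ℤ} (hw : SuppBideg i j w) :
    SuppBideg (i + 1) j (G.totalD ℤ 0 0 w) := by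
  intro s' hs'
  rw [totalD_apply]
  refine Finset.sum_eq_zero fun s _ ↦ ?_
  by_cases h0 : G.incidence ℤ 0 0 s s' = 0
  · rw [h0, zero_mul]
  · rw [hw s (fun hs ↦ hs' ⟨by rw [homDegree_eq_of_incidence_ne_zero h0, hs.1],
      by rw [qDegree_eq_of_incidence_ne_zero_holds h0, hs.2]⟩), mul_zero]

/-- **The differentials of `KhComplex` are the restrictions of the total differential**:
restricting `totalD` of an extension by zero from degree `i` to degree `i'` is `khovanovD i i'`.
[folklore] -/
theorem resFun_totalD_extZero (h t : R) (i i' : ℤ) (v : G.degStates i → R) :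
    resFun R (fun s : G.EnhancedState ↦ homDegree s = i')
        (G.totalD R h t (extZero R (fun s : G.EnhancedState ↦ homDegree s = i) v)) =
      G.khovanovD R h t i i' v := by
  funext s'
  rw [resFun_apply, totalD_apply, sum_mul_extZero]
  simp [khovanovD, Matrix.toLin'_apply, Matrix.mulVec, dotProduct]

/-- The bigraded integral differentials are the restrictions of the total differential.
[folklore] -/
theorem resFun_totalD_extZero_bideg (i i' j : ℤ) (v : G.bidegStates i j → ℤ) :
    resFun ℤ (fun s : G.EnhancedState ↦ homDegree s = i' ∧ qDegree s = j)
        (G.totalD ℤ 0 0 (extZero ℤ (fun s : G.EnhancedState ↦ homDegree s = i ∧ qDegree s = j) v)) =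
      G.khovanovDQ i i' j v := by
  funext s'
  rw [resFun_apply, totalD_apply, sum_mul_extZero]
  simp [khovanovDQ, Matrix.toLin'_apply, Matrix.mulVec, dotProduct]

end Total

/-! ## Homotopy data on total cochains -/

section Htpy

variable {R : Type} [CommRing R] {G K : GaussDiagram} {h t : R}

variable (R G K h t) in
/-- **Homotopy data between the total Khovanov cochains of two Gauss diagrams**: linear maps
`F : C(G) → C(K)`, `B : C(K) → C(G)`, `H : C(K) → C(K)` on functions on all enhanced states with
`d F = F d`, `d B = B d`, `B F = 1` and `F B - 1 = d H + H d` — a strong deformation retraction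
of `C(K)` onto `C(G)`, the output of the cancellations in Khovanov (2000), §5 / Bar-Natan (2002),
§4. [cite: BarNatan2002, §4] -/
structure HtpyData where
  /-- The chain map `C(G) → C(K)`. -/
  F : (G.EnhancedState → R) →ₗ[R] (K.EnhancedState → R)
  /-- The chain map `C(K) → C(G)`, left inverse to `F`. -/
  B : (K.EnhancedState → R) →ₗ[R] (G.EnhancedState → R)
  /-- The homotopy `F B ≃ 1`. -/
  H : (K.EnhancedState → R) →ₗ[R] (K.EnhancedState → R)
  /-- `F` is a chain map. -/
  F_comm : ∀ w, K.totalD R h t (F w) = F (G.totalD R h t w)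
  /-- `B` is a chain map. -/
  B_comm : ∀ v, G.totalD R h t (B v) = B (K.totalD R h t v)
  /-- `B` is a left inverse of `F`. -/
  B_F : ∀ w, B (F w) = w
  /-- `H` is a homotopy from `1` to `F B`. -/
  F_B : ∀ v, F (B v) - v = K.totalD R h t (H v) + H (K.totalD R h t v)

namespace HtpyData

/-! ### Restriction to homological degrees -/

/-- The chain map `F` between the cochain groups of degree `i`. [folklore] -/
def fDeg (D : HtpyData R G K h t) (i : ℤ) : (G.degStates i → R) →ₗ[R] (K.degStates i → R) :=
  resFun R (fun s : K.EnhancedState ↦ homDegree s = i) ∘ₗ D.F ∘ₗ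
    extZero R (fun s : G.EnhancedState ↦ homDegree s = i)

/-- The chain map `B` between the cochain groups of degree `i`. [folklore] -/
def bDeg (D : HtpyData R G K h t) (i : ℤ) : (K.degStates i → R) →ₗ[R] (G.degStates i → R) :=
  resFun R (fun s : G.EnhancedState ↦ homDegree s = i) ∘ₗ D.B ∘ₗ
    extZero R (fun s : K.EnhancedState ↦ homDegree s = i)

/-- The homotopy `H` from the cochain group of degree `i` to that of degree `i'` (meaningful for
`i' = i - 1`; two free indices avoid casts). [folklore] -/
def hDeg (D : HtpyData R G K h t) (i i' : ℤ) : (K.degStates i → R) →ₗ[R] (K.degStates i' → R) :=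
  resFun R (fun s : K.EnhancedState ↦ homDegree s = i') ∘ₗ D.H ∘ₗ
    extZero R (fun s : K.EnhancedState ↦ homDegree s = i)

variable (D : HtpyData R G K h t)
  (suppF : ∀ (i : ℤ) (w : G.EnhancedState → R), SuppDeg i w → SuppDeg i (D.F w))
  (suppB : ∀ (i : ℤ) (v : K.EnhancedState → R), SuppDeg i v → SuppDeg i (D.B v))
  (suppH : ∀ (i : ℤ) (v : K.EnhancedState → R), SuppDeg i v → SuppDeg (i - 1) (D.H v))

include suppF in
/-- `F` is a chain map degreewise. [folklore] -/
theorem khovanovD_fDeg (i : ℤ) (v : G.degStates i → R) :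
    K.khovanovD R h t i (i + 1) (D.fDeg i v) = D.fDeg (i + 1) (G.khovanovD R h t i (i + 1) v) := by
  simp only [fDeg, LinearMap.comp_apply]
  rw [← resFun_totalD_extZero, ← resFun_totalD_extZero,
    extZero_resFun (suppF i _ (suppDeg_extZero i v)),
    extZero_resFun (suppDeg_totalD h t (suppDeg_extZero i v)), D.F_comm]

include suppB in
/-- `B` is a chain map degreewise. [folklore] -/
theorem khovanovD_bDeg (i : ℤ) (v : K.degStates i → R) :
    G.khovanovD R h t i (i + 1) (D.bDeg i v) = D.bDeg (i + 1) (K.khovanovD R h t i (i + 1) v) := by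
  simp only [bDeg, LinearMap.comp_apply]
  rw [← resFun_totalD_extZero, ← resFun_totalD_extZero,
    extZero_resFun (suppB i _ (suppDeg_extZero i v)),
    extZero_resFun (suppDeg_totalD h t (suppDeg_extZero i v)), D.B_comm]

include suppF in
/-- `B F = 1` degreewise. [folklore] -/
theorem bDeg_fDeg (i : ℤ) (v : G.degStates i → R) : D.bDeg i (D.fDeg i v) = v := by
  simp only [fDeg, bDeg, LinearMap.comp_apply]
  rw [extZero_resFun (suppF i _ (suppDeg_extZero i v)), D.B_F, resFun_extZero]

include suppB suppH in
/-- `F B - 1 = d H + H d` degreewise. [folklore] -/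
theorem fDeg_bDeg_sub (i : ℤ) (y : K.degStates i → R) :
    D.fDeg i (D.bDeg i y) - y = K.khovanovD R h t (i - 1) i (D.hDeg i (i - 1) y) +
      D.hDeg (i + 1) i (K.khovanovD R h t i (i + 1) y) := by
  simp only [fDeg, bDeg, hDeg, LinearMap.comp_apply]
  rw [← resFun_totalD_extZero, ← resFun_totalD_extZero,
    extZero_resFun (suppB i _ (suppDeg_extZero i y)),
    extZero_resFun (suppDeg_totalD h t (suppDeg_extZero i y))]
  have hH : extZero R (fun s : K.EnhancedState ↦ homDegree s = i - 1)
      (resFun R (fun s : K.EnhancedState ↦ homDegree s = i - 1)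
        (D.H (extZero R (fun s : K.EnhancedState ↦ homDegree s = i) y))) =
      D.H (extZero R (fun s : K.EnhancedState ↦ homDegree s = i) y) :=
    extZero_resFun (suppH i _ (suppDeg_extZero i y))
  rw [hH]
  have key := congrArg (resFun R (fun s : K.EnhancedState ↦ homDegree s = i))
    (D.F_B (extZero R (fun s : K.EnhancedState ↦ homDegree s = i) y))
  rw [map_sub, map_add, resFun_extZero] at key
  exact key

include suppF suppB suppH in
/-- **Homotopy data induce isomorphisms of the homology over the universal Frobenius system** in
every homological degree, provided `F`, `B` preserve the homological degree and `H` lowers it by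
one: the restrictions are mutually inverse up to the homotopy on the concrete homology
`ker dᵢ ⧸ (im dᵢ₋₁ ⊓ ker dᵢ)` (`subquotientEquiv`). Weibel (1994), §1.4; Khovanov (2000), §5;
Bar-Natan (2002), §4. [cite: BarNatan2002, §4] -/
theorem nonempty_iso_frobeniusHomology (i : ℤ) :
    Nonempty (G.frobeniusHomology R h t i ≅ K.frobeniusHomology R h t i) := by
  refine ⟨(subquotientEquiv (G.khovanovD R h t (i - 1) i) (G.khovanovD R h t i (i + 1))
    (K.khovanovD R h t (i - 1) i) (K.khovanovD R h t i (i + 1)) (D.fDeg i) (D.bDeg i)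
    (fun x hx ↦ ?_) (fun x₀ ↦ ?_) (fun y hy ↦ ?_) (fun y₀ ↦ ?_) (fun x _ ↦ ⟨0, ?_⟩)
    (fun y hy ↦ ⟨D.hDeg i (i - 1) y, ?_⟩)).toModuleIso⟩
  · rw [D.khovanovD_fDeg suppF, hx, map_zero]
  · refine ⟨D.fDeg (i - 1) x₀, ?_⟩
    have := D.khovanovD_fDeg suppF (i - 1) x₀
    rw [sub_add_cancel] at this
    exact this
  · rw [D.khovanovD_bDeg suppB, hy, map_zero]
  · refine ⟨D.bDeg (i - 1) y₀, ?_⟩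
    have := D.khovanovD_bDeg suppB (i - 1) y₀
    rw [sub_add_cancel] at this
    exact this
  · rw [map_zero, D.bDeg_fDeg suppF, sub_self]
  · rw [D.fDeg_bDeg_sub suppB suppH, hy, map_zero, add_zero]

/-! ### Restriction to bidegrees (integral theory at `h = t = 0`) -/

variable (E : HtpyData ℤ G K 0 0)

/-- The chain map `F` between the bigraded cochain groups. [folklore] -/
def fBideg (i j : ℤ) : (G.bidegStates i j → ℤ) →ₗ[ℤ] (K.bidegStates i j → ℤ) :=
  resFun ℤ (fun s : K.EnhancedState ↦ homDegree s = i ∧ qDegree s = j) ∘ₗ E.F ∘ₗ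
    extZero ℤ (fun s : G.EnhancedState ↦ homDegree s = i ∧ qDegree s = j)

/-- The chain map `B` between the bigraded cochain groups. [folklore] -/
def bBideg (i j : ℤ) : (K.bidegStates i j → ℤ) →ₗ[ℤ] (G.bidegStates i j → ℤ) :=
  resFun ℤ (fun s : G.EnhancedState ↦ homDegree s = i ∧ qDegree s = j) ∘ₗ E.B ∘ₗ
    extZero ℤ (fun s : K.EnhancedState ↦ homDegree s = i ∧ qDegree s = j)

/-- The homotopy `H` between the bigraded cochain groups of bidegrees `(i, j)` and `(i', j)`.
[folklore] -/
def hBideg (i i' j : ℤ) : (K.bidegStates i j → ℤ) →ₗ[ℤ] (K.bidegStates i' j → ℤ) :=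
  resFun ℤ (fun s : K.EnhancedState ↦ homDegree s = i' ∧ qDegree s = j) ∘ₗ E.H ∘ₗ
    extZero ℤ (fun s : K.EnhancedState ↦ homDegree s = i ∧ qDegree s = j)

variable
  (suppF₂ : ∀ (i j : ℤ) (w : G.EnhancedState → ℤ), SuppBideg i j w → SuppBideg i j (E.F w))
  (suppB₂ : ∀ (i j : ℤ) (v : K.EnhancedState → ℤ), SuppBideg i j v → SuppBideg i j (E.B v))
  (suppH₂ : ∀ (i j : ℤ) (v : K.EnhancedState → ℤ), SuppBideg i j v → SuppBideg (i - 1) j (E.H v))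

include suppF₂ in
/-- `F` is a chain map in each bidegree. [folklore] -/
theorem khovanovDQ_fBideg (i j : ℤ) (v : G.bidegStates i j → ℤ) :
    K.khovanovDQ i (i + 1) j (E.fBideg i j v) = E.fBideg (i + 1) j (G.khovanovDQ i (i + 1) j v) := by
  simp only [fBideg, LinearMap.comp_apply]
  rw [← resFun_totalD_extZero_bideg, ← resFun_totalD_extZero_bideg,
    extZero_resFun (suppF₂ i j _ (suppBideg_extZero i j v)),
    extZero_resFun (suppBideg_totalD (suppBideg_extZero i j v)), E.F_comm]

include suppB₂ in
/-- `B` is a chain map in each bidegree. [folklore] -/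
theorem khovanovDQ_bBideg (i j : ℤ) (v : K.bidegStates i j → ℤ) :
    G.khovanovDQ i (i + 1) j (E.bBideg i j v) = E.bBideg (i + 1) j (K.khovanovDQ i (i + 1) j v) := by
  simp only [bBideg, LinearMap.comp_apply]
  rw [← resFun_totalD_extZero_bideg, ← resFun_totalD_extZero_bideg,
    extZero_resFun (suppB₂ i j _ (suppBideg_extZero i j v)),
    extZero_resFun (suppBideg_totalD (suppBideg_extZero i j v)), E.B_comm]

include suppF₂ in
/-- `B F = 1` in each bidegree. [folklore] -/
theorem bBideg_fBideg (i j : ℤ) (v : G.bidegStates i j → ℤ) : E.bBideg i j (E.fBideg i j v) = v := by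
  simp only [fBideg, bBideg, LinearMap.comp_apply]
  rw [extZero_resFun (suppF₂ i j _ (suppBideg_extZero i j v)), E.B_F, resFun_extZero]

include suppB₂ suppH₂ in
/-- `F B - 1 = d H + H d` in each bidegree. [folklore] -/
theorem fBideg_bBideg_sub (i j : ℤ) (y : K.bidegStates i j → ℤ) :
    E.fBideg i j (E.bBideg i j y) - y = K.khovanovDQ (i - 1) i j (E.hBideg i (i - 1) j y) +
      E.hBideg (i + 1) i j (K.khovanovDQ i (i + 1) j y) := by
  simp only [fBideg, bBideg, hBideg, LinearMap.comp_apply]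
  rw [← resFun_totalD_extZero_bideg, ← resFun_totalD_extZero_bideg,
    extZero_resFun (suppB₂ i j _ (suppBideg_extZero i j y)),
    extZero_resFun (suppBideg_totalD (suppBideg_extZero i j y))]
  have hH : extZero ℤ (fun s : K.EnhancedState ↦ homDegree s = i - 1 ∧ qDegree s = j)
      (resFun ℤ (fun s : K.EnhancedState ↦ homDegree s = i - 1 ∧ qDegree s = j)
        (E.H (extZero ℤ (fun s : K.EnhancedState ↦ homDegree s = i ∧ qDegree s = j) y))) =
      E.H (extZero ℤ (fun s : K.EnhancedState ↦ homDegree s = i ∧ qDegree s = j) y) :=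
    extZero_resFun (suppH₂ i j _ (suppBideg_extZero i j y))
  rw [hH]
  have key := congrArg (resFun ℤ (fun s : K.EnhancedState ↦ homDegree s = i ∧ qDegree s = j))
    (E.F_B (extZero ℤ (fun s : K.EnhancedState ↦ homDegree s = i ∧ qDegree s = j) y))
  rw [map_sub, map_add, resFun_extZero] at key
  exact key

include suppF₂ suppB₂ suppH₂ in
/-- **Homotopy data of bidegree `(0, 0)` (with a homotopy of bidegree `(-1, 0)`) induce
isomorphisms of the bigraded integral Khovanov homology** `Kh^{i,j}(G) ≅ Kh^{i,j}(K)` in every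
bidegree (`subquotientEquiv` on the restrictions). Weibel (1994), §1.4; Khovanov (2000), §5,
Thm. 1; Bar-Natan (2002), §4. [cite: Khovanov2000, §5] -/
theorem nonempty_iso_khovanovHomology (i j : ℤ) :
    Nonempty (G.khovanovHomology i j ≅ K.khovanovHomology i j) := by
  refine ⟨(subquotientEquiv (G.khovanovDQ (i - 1) i j) (G.khovanovDQ i (i + 1) j)
    (K.khovanovDQ (i - 1) i j) (K.khovanovDQ i (i + 1) j) (E.fBideg i j) (E.bBideg i j)
    (fun x hx ↦ ?_) (fun x₀ ↦ ?_) (fun y hy ↦ ?_) (fun y₀ ↦ ?_) (fun x _ ↦ ⟨0, ?_⟩)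
    (fun y hy ↦ ⟨E.hBideg i (i - 1) j y, ?_⟩)).toModuleIso⟩
  · rw [E.khovanovDQ_fBideg suppF₂, hx, map_zero]
  · refine ⟨E.fBideg (i - 1) j x₀, ?_⟩
    have := E.khovanovDQ_fBideg suppF₂ (i - 1) j x₀
    rw [sub_add_cancel] at this
    exact this
  · rw [E.khovanovDQ_bBideg suppB₂, hy, map_zero]
  · refine ⟨E.bBideg (i - 1) j y₀, ?_⟩
    have := E.khovanovDQ_bBideg suppB₂ (i - 1) j y₀
    rw [sub_add_cancel] at this
    exact this
  · rw [map_zero, E.bBideg_fBideg suppF₂, sub_self]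
  · rw [E.fBideg_bBideg_sub suppB₂ suppH₂, hy, map_zero, add_zero]

end HtpyData

end Htpy

end GaussDiagram

end Literature.Topology.FourManifolds
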